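import Summits.QuantumFields.YangMills.Theorems.BalabanUVNodesPortS1JacKStepCoreDefs
import Summits.QuantumFields.YangMills.Theorems.BalabanUVNodesPortS1JacKStepReading

/-!
# NODE O port PT-A — `JacKStepCore F → JacKStep F`: the `k`-step reading of the record space FROM [B7] Props. 1–2 for complex small fields on the tower region (the record, the gauge orbit, the
# coordinates and the cube letter are read away: `…JacKStepReading` + (i)(ii)(iii) restricted to the tower region)

Cell `ym-nodeO-ideate`, porter seat `ymgap-nodeO-port-PTA-1` (gen 6); proof file, `--supports stmt-QuantumFields-27930`.  [I] = [Balaban1987RG1], [B7] = [Balaban1985Averaging].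
CONTENTS (theorems only).
* ★★ `exists_gauge_towerSmallField_of_mem_recordUc` — at a pair of `recordUc … (X(c))`: the reading's `det = 1` gauge transform `φ^u = embedPair Φ₀` has `det (φ^u).1 = 1` on the tower region's
  fine bonds and `TowerSmallField k c (eta (k+1)) α₀ α₁ (φ^u).1` ((i)(ii)(iii) of `Φ₀` restricted to the region ⊆ «in X(c)»).
* ★★★ `jacKStep_of_core : JacKStepCore F → JacKStep F`, `jacKStep_all_of_core`.
After this file the open P0-free work on PT-A's side is EXACTLY `JacKStepCore F` (record-free, orbit-free): [B7] Props. 1–2 for `SL(2,ℂ)`-valued small fields `e^{iξA}U` in loop currency.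

HONEST FRAMING.  Bookkeeping over 11b's (1.11)–(1.16) predicates and the porter's reading; NOTHING of Bałaban asserted or proved; `JacKStepCore` ∕ `stub_LZjacKStep` ∕ `stub_LZjacDom` OPEN; 27930
OPEN · no claim; K0⁷∕K-Ax OPEN; NODE O 0∕1; COUNT 8∕28 · K 1∕4 UNMOVED; finite `𝕋⁴_{L^K}` at fixed ε — NOT continuum ∕ OS ∕ Clay; **the Yang–Mills mass gap is NOT proved by any of this.**
No `sorry`, no `def`, no `instance`, no `notation`; standard axioms.
-/

noncomputable section

open scoped BigOperators Matrix.Norms.L2Operator Topology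

namespace Summit.QuantumFields.YangMills.Theorems.BalabanUVNodesPortS1

open Summit.QuantumFields.YangMills.Theorems.K0RecordFormatNames
open Literature.MathematicalPhysics.QuantumFieldTheory.Balaban1983to89
open Literature.MathematicalPhysics.QuantumFieldTheory.Balaban1983to89.Node00
open Literature.MathematicalPhysics.QuantumFieldTheory.Balaban1983to89.T4Continuum (T4Family)
open Literature.MathematicalPhysics.QuantumFieldTheory.Balaban1983to89.B10Eq42TorusConstraint (bondsIn)

/-! ## §1  `JacKStepCore F → JacKStep F`: reading a record pair on the tower region -/

section CoreGlue

variable (F : T4Family)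

/-- **THE (i)(ii)(iii) DATA OF A RECORD PAIR ON THE TOWER REGION**: for a pair of `recordUc … (X(c))`, the reading's `det = 1` gauge transform `φ^u = embedPair Φ₀` has first component a
`TowerSmallField k c (eta (k+1)) α₀ α₁` — (i)(ii)(iii) of `Φ₀` on the record frame of `X(c)` restricted to the tower region of `c` (its bonds, plaquettes and derivative squares lie «in X(c)»,
`…JacKStepReading.mem_domSites_domOfBond_of_blockIter`). [cite: Balaban1987RG1, (1.11)–(1.14) p.262, (1.7) p.261] -/
theorem exists_gauge_towerSmallField_of_mem_recordUc {Mc k n : ℕ} (hMc : McGuard F Mc) (c : PBond (F.P (recordK₀ F Mc k + n)) (k + 1)) {α₀ α₁ : ℝ}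
    {φ : Sect2.CPair (F.P (recordK₀ F Mc k + n)) (MatA 2)}
    (hφ : encodeCfg F (recordK₀ F Mc k + n) φ ∈ recordUc F Mc k α₀ α₁ (recordK₀ F Mc k + n) (domOfBond F Mc k (recordK₀ F Mc k + n) c)) :
    ∃ u : Site (F.P (recordK₀ F Mc k + n)) 0 → (MatA 2)ˣ, (∀ x, ((u x : (MatA 2)ˣ) : MatA 2).det = 1) ∧
      (∀ b : PBond (F.P (recordK₀ F Mc k + n)) 0,
        b ∈ bondsIn 0 (B14.Eq22Determines.blockIter (k + 1) ⁻¹' ({c.src, c.tgt} : Set (Site (F.P (recordK₀ F Mc k + n)) (k + 1)))) →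
          ((Sect2.cAct u φ).1 b).det = 1) ∧
      TowerSmallField k c ((F.P (recordK₀ F Mc k + n)).eta (k + 1)) α₀ α₁ (Sect2.cAct u φ).1 := by
  obtain ⟨u, Φ₀, hu, hS, hact, hdet⟩ := exists_gauge_towerDet_of_mem_recordUc F hMc c hφ
  refine ⟨u, hu, hdet, ?_⟩
  have hK : recordK₀ F Mc k ≤ recordK₀ F Mc k + n := Nat.le_add_right _ _
  -- sites of the tower region lie in the record domain's site set
  have hsite : ∀ {x : Site (F.P (recordK₀ F Mc k + n)) 0},
      x ∈ B14.Eq22Determines.blockIter (k + 1) ⁻¹' ({c.src, c.tgt} : Set (Site (F.P (recordK₀ F Mc k + n)) (k + 1))) →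
        x ∈ Sect2.domSites (F.P (recordK₀ F Mc k + n)) Mc (k + 1) (domOfBond F Mc k (recordK₀ F Mc k + n) c) := fun hx =>
    mem_domSites_domOfBond_of_blockIter F hMc hK c ((B15AveragingHolomorphicTowerRegion.mem_preimage_blockIter_pair_iff c _).1 hx)
  obtain ⟨_, _, U, A', hf, h1, h2, h3, -, -⟩ := hS
  have hU : Φ₀.U = fun b => B12RegularSpaces111.expI ((F.P (recordK₀ F Mc k + n)).eta (k + 1)) (A' b) * U b := funext hf
  refine ⟨U, A', fun b hb => ?_, fun p hp => ?_, fun q hq1 hq2 hq3 hq4 => ?_⟩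
  · obtain ⟨hb1, hb2⟩ := src_tgt_mem_domSites_of_mem_bondsIn_towerRegion F hMc hK c hb
    refine ⟨?_, ?_, ?_, ?_⟩
    · rw [hact]
      exact congrArg (fun v : (MatA 2)ˣ => (v : MatA 2)) (hf b)
    · exact B12RegularSpaces111SpecialUnitary.mem_suModel_G.1 (h1.gValued b ⟨hb1, hb2⟩)
    · exact B12RegularSpaces111SpecialUnitary.mem_suModel_gc.1 (h2.gcValued b ⟨hb1, hb2⟩)
    · exact h2.norm_lt b ⟨hb1, hb2⟩
  · obtain ⟨hp1, hp2, hp3, hp4⟩ := hp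
    have hp' : p ∈ plaqInside (Sect2.domSites (F.P (recordK₀ F Mc k + n)) Mc (k + 1) (domOfBond F Mc k (recordK₀ F Mc k + n) c)) :=
      ⟨hsite hp1, hsite hp2, hsite hp3, hsite hp4⟩
    refine ⟨h1.plaq_lt p hp', ?_⟩
    rw [← hU]
    exact h3.plaq_lt p hp'
  · exact h2.nabla_lt q ⟨hsite hq1, hsite hq2, hsite hq3, hsite hq4⟩

/-- ★★★ **`JacKStepCore F → JacKStep F`**: [B7] Props. 1–2 for complex small fields on the tower region (loop currency) give the `k`-step reading of the record space — at a record pair, gauge-fix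
by the reading (`exists_gauge_towerDet_of_mem_recordUc`), read (i)(ii)(iii) on the tower region (`exists_gauge_towerSmallField_of_mem_recordUc`), apply the core, and add the `det` clause.
[cite: Balaban1987RG1, p.263 L8–10, (1.11)–(1.16) p.262; Balaban1985Averaging, Prop. 2 (54) p.26] -/
theorem jacKStep_of_core (h : JacKStepCore F) : JacKStep F := by
  intro a ha
  obtain ⟨α₀, α₁, hα₀, hα₁, hcore⟩ := h a ha
  refine ⟨0, fun Mc _ hMcG => ⟨α₀, α₁, hα₀, hα₁, fun k n c φ hφ => ?_⟩⟩
  obtain ⟨u, hu, hdet, hT⟩ := exists_gauge_towerSmallField_of_mem_recordUc F hMcG c hφ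
  have hk : k + 1 ≤ (F.P (recordK₀ F Mc k + n)).m + (F.P (recordK₀ F Mc k + n)).K := by
    rw [F.P_K]; unfold recordK₀; omega
  exact ⟨u, hu, hdet, hcore k _ hk c _ hT⟩

/-- The global form. [cite: Balaban1987RG1, p.263 L8–10] -/
theorem jacKStep_all_of_core (h : ∀ F : T4Family, JacKStepCore F) : ∀ F : T4Family, JacKStep F :=
  fun F => jacKStep_of_core F (h F)

end CoreGlue

end Summit.QuantumFields.YangMills.Theorems.BalabanUVNodesPortS1

end
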